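import Summits.HodgeConjecture.FermatCycles.HodgeFermatPropL7aA

/-!
# PROPOSITION L7(a) at the levels prime to 3 — part 2: `row_UZ1_seven_not3` (`HodgeFermat/PropL7a.lean`; HF-G21f)

Tree copy (part 2 of 2) of the module `HodgeFermat/PropL7a.lean` of the sibling cell's standalone package
`run/shared/lean/pub/pub-hodgefermat/lean/HodgeFermat/` (499 lines, sha256 `9b148baeb65a0a99…`), source lines 237–499 (§§3–4: `sameType_descend`, `z3_vs_any`, `seven_le_prime`, PROPOSITION L7(a) `row_UZ1_seven_not3_of`, `row_UZ1_seven_not3`).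
Filed by cell `pub-hfermat`, seat prover-1 gen-3, on the COORDINATOR KEEPER RULING of 2026-08-25 (gem sweep H1: take the
off-gate kernel theorem `thmFstar` through the gate) — here THEOREM F* of `tables/DPRIME-THEOREM.md` §9 IN FULL, i.e.
PROPOSITION D′(3N) and the descent (`HodgeFermat/PropDPrimeNFinal.lean`, GATE HF-G34), the last off-gate form of THEOREM F*
(its first two forms, `DecodingFinal.thmFstar` = F* at the prime levels and `ThmFstarNFinal.thmFstar` = F*(3N), landed on
2026-08-25 as `HodgeFermatThmFstar.lean` / `HodgeFermatThmFstarN.lean`, seats prover-1 gen-0 / gen-2); this file is one link of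
the import closure of `PropDPrimeNFinal.propDprime` (the sibling's KR-free chain: THEOREM L, COROLLARY M, THEOREM D6,
THEOREM U⁺, THEOREM KR6, THEOREM Z3U) on top of those landed chains.  The source module is the sibling's hub-checked module of
record (pub-hodgefermat `CERT.md` l.879, GATE HF-G21f; cell record `check/PropL7a_standalone.lean` sha256 `b35a6b56b24ad008…`); its declarations are copied VERBATIM.
Deviations from the source module, exhaustively: the `import` lines (tree modules `Summits.HodgeConjecture.FermatCycles.
HodgeFermat*` instead of `HodgeFermat.*`); this module docstring; the `set_option`/namespace/`open` preamble (source l.30–34) and part 1's three re-binding `open` lines are repeated at the top because the module is split (`sameType_descend`, `z3_vs_any` stay here: their later VERBATIM copies in the sibling's `Descent.lean` are the ones deleted, in `HodgeFermatDescent.lean`). The module docstring is quoted in full in part 1.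
Every other line — in particular every declaration's statement and proof — is byte-identical to the source.
HONEST FRAMING: explicit algebraic cycles for specific Hodge classes on Fermat/Delsarte varieties; residual open instances
listed; no claim on general Hodge.  (This file is arithmetic of CM types / finite combinatorics / analytic number theory
of the sibling's KR-free programme; it claims nothing about cycles.)
-/

set_option autoImplicit false

namespace HodgeFermat.KRFree.TheoremL

open HodgeFermat.KRFree HodgeFermat.KRFree.LemmaN HodgeFermat.KRFree.LemmaO HodgeFermat.KRFree.Bridge

open HodgeFermat.KRFree.Decoding renaming st_symm → sameType_symm, st_trans → sameType_trans, st_swap → sameType_swap, st_rot → sameType_rot, unit_mul_not_dvd → not_dvd_unit_mul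
open HodgeFermat.KRFree.Decoding (rsum_swap rsum_rot)
open HodgeFermat.KRFree.TheoremZ3U renaming not_dvd_cofactor' → not_dvd_cofactor, rsum_const₃ → rsum_const_of_dvd

/-! ## §3  Descent -/

/-- dividing the level and the entries by a common factor `G` preserves "same CM type" -/
lemma sameType_descend {G n₁ a b c a' b' c' : ℕ} (hG : 0 < G) (hn₁ : 0 < n₁)
    (h : SameType (G * n₁) (G * a, G * b, G * c) (G * a', G * b', G * c')) :
    SameType n₁ (a, b, c) (a', b', c') := by
  intro t ht
  obtain ⟨u, hu, hut⟩ := unit_lift (G * n₁) n₁ t (Nat.mul_pos hG hn₁) (dvd_mul_left n₁ G) ht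
  have h1 := h u hu
  have e : ∀ x, u * (G * x) % (G * n₁) = G * (t * x % n₁) := by
    intro x
    rw [show u * (G * x) = G * (u * x) by ring, Nat.mul_mod_mul_left]
    congr 1
    exact Nat.ModEq.mul_right x hut
  have k2 : ∀ p q : ℕ, G * p + G * q < G * n₁ ↔ p + q < n₁ := by
    intro p q
    rw [← mul_add]
    exact ⟨Nat.lt_of_mul_lt_mul_left, fun hh => Nat.mul_lt_mul_of_pos_left hh hG⟩
  unfold InH at h1 ⊢; dsimp only at h1 ⊢
  simp only [e, k2] at h1
  exact h1

/-- a Z3-at-`q` triple never has the CM type of a triple that is not Z3 at `q` (`q ≥ 7` prime, `q ∤ N'`, `N'`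
odd, the second triple with no entry `≡ 0 (mod qN')`): rows (Z3,U) and (Z3,Z1) of THEOREM L, up to a permutation -/
theorem z3_vs_any (q N' a b c u v w : ℕ) (hq : q.Prime) (h7 : 7 ≤ q) (hqN : ¬ q ∣ N') (hN : 0 < N')
    (hodd : Odd N') (hs : q * N' ∣ u + v + w) (hne : ¬ (q ∣ u ∧ q ∣ v ∧ q ∣ w))
    (hu : ¬ q * N' ∣ u) (hv : ¬ q * N' ∣ v) (hw : ¬ q * N' ∣ w)
    (hH : SameType (q * N') (q * a, q * b, q * c) (u, v, w)) : False := by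
  have h5 : 5 ≤ q := by omega
  have hN0 : 0 < q * N' := Nat.mul_pos hq.pos hN
  -- two entries divisible by q force the third
  have two : ∀ {r s₁ s₂ : ℕ}, q * N' ∣ r + s₁ + s₂ → q ∣ s₁ → q ∣ s₂ → q ∣ r := by
    intro r s₁ s₂ hsum h1 h2
    have hq' : q ∣ r + (s₁ + s₂) := by
      rw [← add_assoc]; exact Nat.dvd_trans (dvd_mul_right q N') hsum
    exact (Nat.dvd_add_left (dvd_add h1 h2)).mp hq'
  by_cases hqu : q ∣ u
  · by_cases hqv : q ∣ v
    · exact hne ⟨hqu, hqv, two (by rwa [show w + u + v = u + v + w by ring]) hqu hqv⟩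
    · by_cases hqw : q ∣ w
      · exact hqv (two (by rwa [show v + u + w = u + v + w by ring]) hqu hqw)
      · obtain ⟨y₀, rfl⟩ := hqu
        have hy₀ : ¬ N' ∣ y₀ := fun h => hu (Nat.mul_dvd_mul_left q h)
        exact row_Z3Z1_seven q N' a b c y₀ v w hq h7 hqN hN hodd hs hqv hqw hy₀ hH
  · by_cases hqv : q ∣ v
    · by_cases hqw : q ∣ w
      · exact hqu (two hs hqv hqw)
      · obtain ⟨y₀, rfl⟩ := hqv
        have hy₀ : ¬ N' ∣ y₀ := fun h => hv (Nat.mul_dvd_mul_left q h)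
        have hH' : SameType (q * N') (q * a, q * b, q * c) (q * y₀, u, w) :=
          sameType_trans hH (sameType_swap hN0 hs hw)
        have hs2 : q * N' ∣ q * y₀ + u + w := by rwa [show q * y₀ + u + w = u + q * y₀ + w by ring]
        exact row_Z3Z1_seven q N' a b c y₀ u w hq h7 hqN hN hodd hs2 hqu hqw hy₀ hH'
    · by_cases hqw : q ∣ w
      · obtain ⟨y₀, rfl⟩ := hqw
        have hy₀ : ¬ N' ∣ y₀ := fun h => hw (Nat.mul_dvd_mul_left q h)
        have hH' : SameType (q * N') (q * a, q * b, q * c) (q * y₀, u, v) :=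
          sameType_trans hH (sameType_rot hN0 hs hv hw)
        have hs2 : q * N' ∣ q * y₀ + u + v := by rwa [show q * y₀ + u + v = u + v + q * y₀ by ring]
        exact row_Z3Z1_seven q N' a b c y₀ u v hq h7 hqN hN hodd hs2 hqu hqv hy₀ hH'
      · exact row_Z3U q N' a b c u v w hq h5 hqN hN hs hqu hqv hqw hH

/-- an odd squarefree number prime to 3 and 7 has all its prime factors `≥ 11` except possibly 5; here: a prime
factor `q` with `q² ∣` excluded and `q ≠ 5` is `≥ 7` (all that `z3_vs_any` needs) -/
lemma seven_le_prime {q n : ℕ} (hq : q.Prime) (hqn : q ∣ n) (hodd : Odd n) (h3 : ¬ 3 ∣ n) (hq5 : q ≠ 5) :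
    7 ≤ q := by
  have hq2 : q ≠ 2 := by
    rintro rfl
    exact (Nat.not_even_iff_odd.mpr hodd) (even_iff_two_dvd.mpr hqn)
  have hq3 : q ≠ 3 := by rintro rfl; exact h3 hqn
  by_contra hlt
  have hlt' : q < 7 := by omega
  interval_cases q <;> first | omega | exact absurd hq (by decide)

/-! ## §4  PROPOSITION L7(a) at `3 ∤ n` -/

/-- PROPOSITION L7(a) (`tables/DPRIME-THEOREM.md` §3) at the levels prime to 3, over `CoincidenceFree 35` as a
hypothesis: at an odd squarefree level `m = 7n`, `7 ∤ n`, `3 ∤ n`, a jointly primitive pair {T = (7y, x₂, x₃)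
of class Z1 at 7, T' = (x', y', z') of class U at 7} with `n ∤ y` (T not itself Z3·unit-degenerate) never has
equal CM types.  Joint primitivity is the hypothesis `hjp` (no prime divides the level and all six entries). -/
theorem row_UZ1_seven_not3_of (hF : CoincidenceFree 35) (n y x₂ x₃ x' y' z' : ℕ) (hsq : Squarefree n)
    (h7n : ¬ 7 ∣ n) (h3 : ¬ 3 ∣ n) (hn : 0 < n) (hodd : Odd n)
    (hs : 7 * n ∣ 7 * y + x₂ + x₃) (hx₂ : ¬ 7 ∣ x₂) (hx₃ : ¬ 7 ∣ x₃)
    (hs' : 7 * n ∣ x' + y' + z') (hx' : ¬ 7 ∣ x') (hy' : ¬ 7 ∣ y') (hz' : ¬ 7 ∣ z') (hy : ¬ n ∣ y)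
    (hjp : Nat.gcd (7 * n) (Nat.gcd (7 * y) (Nat.gcd x₂ (Nat.gcd x₃ (Nat.gcd x' (Nat.gcd y' z'))))) = 1)
    (hH : SameType (7 * n) (7 * y, x₂, x₃) (x', y', z')) : False := by
  have hp : (7).Prime := by norm_num
  obtain ⟨hn5, hx'n, hy'n, hz'n, hT⟩ :=
    UZ1_seven_pointwise n y x₂ x₃ x' y' z' h7n hn hodd h3 hs hx₂ hx₃ hs' hx' hy' hz' hy hH
  obtain ⟨g, hg⟩ : ∃ g, Nat.gcd y n = g := ⟨_, rfl⟩
  have hg0 : 0 < g := by rw [← hg]; exact Nat.gcd_pos_of_pos_right _ hn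
  rw [hg] at hn5
  have hgn : g ∣ n := by rw [← hg]; exact Nat.gcd_dvd_right y n
  have hgy : g ∣ y := by rw [← hg]; exact Nat.gcd_dvd_left y n
  have hsn' : n ∣ x' + y' + z' := dvd_of_level hs'
  -- squarefree: 5 ∤ g (else 25 ∣ n), and q ∣ g prime ⇒ q ∤ n/q
  have hsq' : ∀ q : ℕ, q.Prime → q * q ∣ n → False := fun q hq hqq =>
    hq.one_lt.ne' (Nat.isUnit_iff.mp (hsq q hqq))
  have h5g : ¬ 5 ∣ g := by
    rintro ⟨g', rfl⟩
    exact hsq' 5 (by norm_num) ⟨g', by rw [hn5]; ring⟩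
  /- STEP A (DESCENT LEMMA): g ∣ x', y', z'.  Let G = gcd(g, x', y', z'); write g = G g₁ etc.; at level
     n₁ = n/G = 5 g₁ the pair {T̄'/G, V/G} is jointly primitive and V/G = g₁ (y/g)(1,1,3) is Z3 at every prime
     q ∣ g₁ (q ≥ 11) — impossible by `z3_vs_any` unless g₁ = 1. -/
  obtain ⟨G, hG⟩ : ∃ G, Nat.gcd g (Nat.gcd x' (Nat.gcd y' z')) = G := ⟨_, rfl⟩
  have hG0 : 0 < G := by rw [← hG]; exact Nat.gcd_pos_of_pos_left _ hg0
  have hGg : G ∣ g := by rw [← hG]; exact Nat.gcd_dvd_left _ _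
  have hGx : G ∣ x' := by rw [← hG]; exact Nat.dvd_trans (Nat.gcd_dvd_right _ _) (Nat.gcd_dvd_left _ _)
  have hGy : G ∣ y' := by
    rw [← hG]; exact Nat.dvd_trans (Nat.gcd_dvd_right _ _) (Nat.dvd_trans (Nat.gcd_dvd_right _ _) (Nat.gcd_dvd_left _ _))
  have hGz : G ∣ z' := by
    rw [← hG]; exact Nat.dvd_trans (Nat.gcd_dvd_right _ _) (Nat.dvd_trans (Nat.gcd_dvd_right _ _) (Nat.gcd_dvd_right _ _))
  have hGmax : ∀ d, d ∣ g → d ∣ x' → d ∣ y' → d ∣ z' → d ∣ G := by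
    intro d h1 h2 h3 h4; rw [← hG]
    exact Nat.dvd_gcd h1 (Nat.dvd_gcd h2 (Nat.dvd_gcd h3 h4))
  obtain ⟨g₁, hg₁⟩ := hGg
  obtain ⟨a, ha⟩ := hGx
  obtain ⟨b, hb⟩ := hGy
  obtain ⟨c, hc⟩ := hGz
  obtain ⟨yq, hyq⟩ := hgy
  have hg₁0 : 0 < g₁ := by
    rcases Nat.eq_zero_or_pos g₁ with h0 | h0
    · rw [h0, mul_zero] at hg₁; omega
    · exact h0
  -- the descended coincidence at level n₁ = 5 g₁
  have hn₁ : n = G * (5 * g₁) := by rw [hn5, hg₁]; ring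
  have hT₁ : SameType (5 * g₁) (a, b, c) (g₁ * yq, g₁ * yq, 3 * (g₁ * yq)) := by
    have h' : SameType (G * (5 * g₁)) (G * a, G * b, G * c)
        (G * (g₁ * yq), G * (g₁ * yq), G * (3 * (g₁ * yq))) := by
      rw [← hn₁, ← ha, ← hb, ← hc, show G * (g₁ * yq) = y by rw [hyq, hg₁]; ring,
        show G * (3 * (g₁ * yq)) = 3 * y by rw [hyq, hg₁]; ring]
      exact hT
    exact sameType_descend hG0 (by omega) h'
  have hg₁1 : g₁ = 1 := by
    by_contra hne1
    obtain ⟨q, hq, hqg₁⟩ := Nat.exists_prime_and_dvd hne1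
    have hqg : q ∣ g := by rw [hg₁]; exact Dvd.dvd.mul_left hqg₁ G
    have hqn : q ∣ n := Nat.dvd_trans hqg hgn
    have hq5 : q ≠ 5 := by rintro rfl; exact h5g hqg
    have h7q : 7 ≤ q := seven_le_prime hq hqn hodd h3 hq5
    -- level n₁ = 5 g₁ = q · N'
    obtain ⟨g₂, hg₂⟩ := hqg₁
    have hlev : 5 * g₁ = q * (5 * g₂) := by rw [hg₂]; ring
    have hN'0 : 0 < 5 * g₂ := by
      rcases Nat.eq_zero_or_pos g₂ with h0 | h0
      · rw [h0, mul_zero] at hg₂; omega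
      · omega
    have hqN' : ¬ q ∣ 5 * g₂ := by
      intro hd
      apply hsq' q hq
      rw [hn₁, hlev]
      exact Dvd.dvd.mul_left (Nat.mul_dvd_mul_left q hd) G
    have hoddN' : Odd (5 * g₂) := by
      refine Odd.of_dvd_nat hodd ⟨G * q, ?_⟩
      rw [hn₁, hlev]; ring
    -- the descended pair at level q·(5g₂): V/G = q·(g₂ yq)(1,1,3) is Z3 at q; T̄'/G = (a,b,c) is not
    have hne : ¬ (q ∣ a ∧ q ∣ b ∧ q ∣ c) := by
      rintro ⟨⟨a₁, rfl⟩, ⟨b₁, rfl⟩, ⟨c₁, rfl⟩⟩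
      have hd := hGmax (G * q) (by rw [hg₁, hg₂]; exact ⟨g₂, by ring⟩) (by rw [ha]; exact ⟨a₁, by ring⟩)
        (by rw [hb]; exact ⟨b₁, by ring⟩) (by rw [hc]; exact ⟨c₁, by ring⟩)
      have := Nat.le_of_dvd hG0 hd
      have h2 : G * 2 ≤ G * q := Nat.mul_le_mul_left G hq.two_le
      omega
    have hsum : q * (5 * g₂) ∣ a + b + c := by
      rw [← hlev]
      have : G * (5 * g₁) ∣ G * (a + b + c) := by
        rw [← hn₁, show G * (a + b + c) = x' + y' + z' by rw [ha, hb, hc]; ring]; exact hsn'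
      exact Nat.dvd_of_mul_dvd_mul_left hG0 this
    have hna : ¬ q * (5 * g₂) ∣ a := by
      rw [← hlev]; intro hd; apply hx'n; rw [hn₁, ha]; exact Nat.mul_dvd_mul_left G hd
    have hnb : ¬ q * (5 * g₂) ∣ b := by
      rw [← hlev]; intro hd; apply hy'n; rw [hn₁, hb]; exact Nat.mul_dvd_mul_left G hd
    have hnc : ¬ q * (5 * g₂) ∣ c := by
      rw [← hlev]; intro hd; apply hz'n; rw [hn₁, hc]; exact Nat.mul_dvd_mul_left G hd
    have hH₁ : SameType (q * (5 * g₂)) (q * (g₂ * yq), q * (g₂ * yq), q * (3 * (g₂ * yq))) (a, b, c) := by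
      rw [← hlev, show q * (g₂ * yq) = g₁ * yq by rw [hg₂]; ring,
        show q * (3 * (g₂ * yq)) = 3 * (g₁ * yq) by rw [hg₂]; ring]
      exact sameType_symm hT₁
    exact z3_vs_any q (5 * g₂) (g₂ * yq) (g₂ * yq) (3 * (g₂ * yq)) a b c hq h7q hqN' hN'0 hoddN' hsum hne
      hna hnb hnc hH₁
  -- hence G = g and g ∣ x', y', z'
  rw [hg₁1, mul_one] at hg₁
  have hGn : G ∣ n := by rw [← hg₁]; exact hgn
  have h5G : ¬ 5 ∣ G := by rw [← hg₁]; exact h5g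
  /- STEP B: g = 1.  For a prime q ∣ g: at level m = 7n = q·(7n/q) the triple T' = g·(a,b,c) is Z3 at q while
     T is not (joint primitivity) — impossible by `z3_vs_any`. -/
  have hg1 : G = 1 := by
    by_contra hne1
    obtain ⟨q, hq, hqg⟩ := Nat.exists_prime_and_dvd hne1
    have hqn : q ∣ n := Nat.dvd_trans hqg hGn
    have hq5 : q ≠ 5 := by rintro rfl; exact h5G hqg
    have h7q : 7 ≤ q := seven_le_prime hq hqn hodd h3 hq5
    have hq7 : q ≠ 7 := by rintro rfl; exact h7n hqn
    obtain ⟨n₂, hn₂⟩ := hqn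
    have hlev : 7 * n = q * (7 * n₂) := by rw [hn₂]; ring
    have hN'0 : 0 < 7 * n₂ := by
      rcases Nat.eq_zero_or_pos n₂ with h0 | h0
      · rw [h0, mul_zero] at hn₂; omega
      · omega
    have hqN' : ¬ q ∣ 7 * n₂ := by
      intro hd
      rcases (Nat.Prime.dvd_mul hq).mp hd with h7 | hd₂
      · have := (Nat.prime_dvd_prime_iff_eq hq (by norm_num)).mp h7
        exact hq7 this
      · exact hsq' q hq (by rw [hn₂]; exact Nat.mul_dvd_mul_left q hd₂)
    have hoddN' : Odd (7 * n₂) := by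
      refine Odd.of_dvd_nat (Odd.mul (by decide : Odd 7) hodd) ⟨q, ?_⟩
      rw [hlev]; ring
    obtain ⟨g₃, hg₃⟩ := hqg
    -- T is not Z3 at q: joint primitivity
    have hne : ¬ (q ∣ 7 * y ∧ q ∣ x₂ ∧ q ∣ x₃) := by
      rintro ⟨h1, h2, h3'⟩
      have hqx : q ∣ x' := by rw [ha, hg₃]; exact ⟨g₃ * a, by ring⟩
      have hqy : q ∣ y' := by rw [hb, hg₃]; exact ⟨g₃ * b, by ring⟩
      have hqz : q ∣ z' := by rw [hc, hg₃]; exact ⟨g₃ * c, by ring⟩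
      have hd : q ∣ Nat.gcd (7 * n) (Nat.gcd (7 * y) (Nat.gcd x₂ (Nat.gcd x₃ (Nat.gcd x' (Nat.gcd y' z'))))) :=
        Nat.dvd_gcd ⟨7 * n₂, hlev⟩ (Nat.dvd_gcd h1 (Nat.dvd_gcd h2 (Nat.dvd_gcd h3' (Nat.dvd_gcd hqx
          (Nat.dvd_gcd hqy hqz)))))
      rw [hjp] at hd
      exact hq.one_lt.ne' (Nat.dvd_one.mp hd)
    have hn7y : ¬ 7 * n ∣ 7 * y := fun hd => hy (Nat.dvd_of_mul_dvd_mul_left (by norm_num) hd)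
    have hnx₂ : ¬ 7 * n ∣ x₂ := fun hd => hx₂ (Nat.dvd_trans (dvd_mul_right 7 n) hd)
    have hnx₃ : ¬ 7 * n ∣ x₃ := fun hd => hx₃ (Nat.dvd_trans (dvd_mul_right 7 n) hd)
    have hH₂ : SameType (q * (7 * n₂)) (q * (g₃ * a), q * (g₃ * b), q * (g₃ * c)) (7 * y, x₂, x₃) := by
      rw [← hlev, show q * (g₃ * a) = x' by rw [ha, hg₃]; ring, show q * (g₃ * b) = y' by rw [hb, hg₃]; ring,
        show q * (g₃ * c) = z' by rw [hc, hg₃]; ring]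
      exact sameType_symm hH
    rw [hlev] at hs hn7y hnx₂ hnx₃
    exact z3_vs_any q (7 * n₂) (g₃ * a) (g₃ * b) (g₃ * c) (7 * y) x₂ x₃ hq h7q hqN' hN'0 hoddN' hs hne
      hn7y hnx₂ hnx₃ hH₂
  /- STEP C: n = 5, m = 35, and F35 -/
  subst hg1
  have hn5' : n = 5 := by omega
  subst hn5'
  have h35y : ¬ 35 ∣ 7 * y := by
    intro hd
    have hd' : 7 * 5 ∣ 7 * y := hd
    exact hy (Nat.dvd_of_mul_dvd_mul_left (by norm_num : 0 < 7) hd')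
  have h35 : ∀ {w : ℕ}, ¬ 7 ∣ w → ¬ 35 ∣ w := fun hw hd => hw (Nat.dvd_trans (by norm_num) hd)
  have h7r : ∀ {w : ℕ}, (7 * y) % 35 = w % 35 → 7 ∣ w := by
    intro w e
    have h1 : 7 ∣ (7 * y) % 35 := (Nat.dvd_mod_iff (by norm_num)).mpr (dvd_mul_right 7 y)
    rw [e] at h1
    exact (Nat.dvd_mod_iff (by norm_num)).mp h1
  rcases coincidenceFree_first hF (by norm_num) (7 * y) x₂ x₃ x' y' z' hs hs' h35y (h35 hx₂) (h35 hx₃)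
      (h35 hx') (h35 hy') (h35 hz') hH with e | e | e
  · exact hx' (h7r e)
  · exact hy' (h7r e)
  · exact hz' (h7r e)

/-- PROPOSITION L7(a) at `3 ∤ n`, unconditionally: `F35` is the kernel-checked fact of `KRFreeFacts.lean`.
(The hypotheses are, by this very theorem, never jointly satisfiable, so no kernel instance can be given; the
search `code/gen21/search_uz1_p7.py` confirms independently that the hypotheses of `UZ1_seven_pointwise` have
no instance at `n ∈ {5, 25, 55}`.  The lemmas are exercised by the kernel instances of `Bridge.lean` and
`TheoremLRows.lean`, and by the planted controls `code/gen21/lean-controls/Control{S,T}_*.lean`.) -/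
theorem row_UZ1_seven_not3 (n y x₂ x₃ x' y' z' : ℕ) (hsq : Squarefree n) (h7n : ¬ 7 ∣ n) (h3 : ¬ 3 ∣ n)
    (hn : 0 < n) (hodd : Odd n) (hs : 7 * n ∣ 7 * y + x₂ + x₃) (hx₂ : ¬ 7 ∣ x₂) (hx₃ : ¬ 7 ∣ x₃)
    (hs' : 7 * n ∣ x' + y' + z') (hx' : ¬ 7 ∣ x') (hy' : ¬ 7 ∣ y') (hz' : ¬ 7 ∣ z') (hy : ¬ n ∣ y)
    (hjp : Nat.gcd (7 * n) (Nat.gcd (7 * y) (Nat.gcd x₂ (Nat.gcd x₃ (Nat.gcd x' (Nat.gcd y' z'))))) = 1)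
    (hH : SameType (7 * n) (7 * y, x₂, x₃) (x', y', z')) : False :=
  row_UZ1_seven_not3_of F35 n y x₂ x₃ x' y' z' hsq h7n h3 hn hodd hs hx₂ hx₃ hs' hx' hy' hz' hy hjp hH

end HodgeFermat.KRFree.TheoremL
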